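import Summits.ResolutionOfSingularities.ResolutionOfSingularities.Theorems.PurelyInseparableDim4ResConeSatellitePair
import Summits.ResolutionOfSingularities.ResolutionOfSingularities.Theorems.PurelyInseparableDim4ResConeStretchKill
import HarnessLib
import HarnessLib.Audit.Tags

/-!
# Purely inseparable four-folds — SLICE B, the SATELLITE PAIR IS LIGHT: with the two (DL) ledgers at hand,
# a satellite step has `oₖ + oₖ₊₁ + 3 ≤ 3p` (cell `res-dim4-pi`, K2(p) lane, brick (K12b), explicit-ledger
# form)

[OURS · counted 0 · cell `res-dim4-pi` · K2(p) lane (holder res-dim4-p-12 g3, naming 23:35:55Z; pointer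
23:49:59Z «state K12b against explicit ledgers over part 1's `stretch_false_of_two_ledgers`») · seat
res-dim4-p-1 g3 · over (K12a) `…ResConeSatellitePair` and res-dim4-p-2 g3's K11 part 1
`…ResConeStretchKill`.]  Nothing here proves K2(p) (slice B OPEN), `NoIsolatedTrap p p` or resolution of
singularities in dimension ≥ 4 / characteristic `p`.  AI kernel work, weaker than expert review.

At a satellite step `k` of a slice-B stretch the letters `a = j k`, `b′ = j (k+1)` are both present at
`c (k+2)` with `r a + r b′ = oₖ + oₖ₊₁ − 2p` (K12a).  If both carry a (DL) ledger at `c (k+2)` —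
`u_a · G ∈ (x_a, h_a^d)`, `u_{b′} · G ∈ (x_{b′}, h_{b′}^d)` with units `u`, `h ∈ 𝔪₀`, `G = F.divMonomial r` —
and the power cone `C a₀ · ℓ^d` of `c (k+2)` has a third letter `e ∉ {a, b′}` with `ℓ e ≠ 0`, then
res-dim4-p-2 g3's `stretch_false_of_two_ledgers` forbids `r a + r b′ + 2 ≥ p`; hence

* **`satellite_pair_light_of_ledgers`** — `r a + r b′ + 3 ≤ p` at `c (k+2)`, and
* **`satellite_orders_add_three_le_of_ledgers`** (K12b, explicit-ledger form) — `oₖ + oₖ₊₁ + 3 ≤ 3p`.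

The ledgers themselves are K11 part 2 (`stretch_ledger`, kept-predicate form, res-dim4-p-2 g3) and the third
letter is K13 (`contactSupport_not_subset_pair`, res-dim4-typ-1 g2); the hypothesis-free (K12b)/(K12c)
«∀ N ∃ k ≥ N, satellite k ∧ oₖ + oₖ₊₁ + 3 ≤ 3p» follow in a sequel importing them.
[cite: CossartJannsenSaito2020, Thm. 3.14] [cite: HauserPerlega2019PRIMS, §2]
bears_on: LADDER-RESOLUTION:D157-DOOR2 (res-dim4-pi · K2(p) lane · slice B · K12b).  Supports
stmt-ResolutionOfSingularities-16155 (helper).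
-/

set_option linter.dupNamespace false -- mandated namespace of this single-conjunct summit

noncomputable section

namespace Summit.ResolutionOfSingularities.ResolutionOfSingularities.Theorems.PIDim4

namespace ResCone

open MvPolynomial Finset
open Literature.AlgebraicGeometry.Resolution
open Literature.AlgebraicGeometry.Resolution.CentreBlowup
open Literature.AlgebraicGeometry.Resolution.Hauser2010
open Literature.AlgebraicGeometry.Resolution.HauserPerlega2019

variable {K : Type} [Field K]

/-- **The satellite pair is LIGHT given its two ledgers**: at `c (k+2)` after a satellite step `k` of a
slice-B stretch (constant shade `2 ≤ d < p` from `k₀ ≤ k`), if the letters `j k`, `j (k+1)` both carry a (DL)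
ledger and the power cone has a third letter, then `r (j k) + r (j (k+1)) + 3 ≤ p`.
[cite: CossartJannsenSaito2020, Thm. 3.14] [folklore] -/
theorem satellite_pair_light_of_ledgers (p : ℕ) [Fact p.Prime] [CharP K p] [DecidableEq K]
    {c : ℕ → State K} {j : ℕ → Fin 4} {b : ℕ → Fin 4 → K}
    (hc : ∀ k, IsIsolated p (c k).F ∧ Step0 p (c k) (c (k + 1)))
    (hr0 : ∀ e ∈ (c 0).F.support, (c 0).r ≤ e) (hfloor : ∀ k, ordZero (c k).F ≠ p) {k₀ d : ℕ}
    (hd2 : 2 ≤ d) (hdp : d < p) (hshade : ∀ k, k₀ ≤ k → (c k).shade = (d : ℕ∞)) {k : ℕ} (hk : k₀ ≤ k)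
    (hsat : FreeTail.IsSatellite j b k) {ℓ : Fin 4 → K} {a₀ : K}
    (hform : resForm (c (k + 2)) = C a₀ * (∑ i, C (ℓ i) * X i) ^ d)
    {e : Fin 4} (hea : e ≠ j k) (heb : e ≠ j (k + 1)) (he : ℓ e ≠ 0)
    {ua ha ub hb : MvPolynomial (Fin 4) K}
    (hua : MvPolynomial.eval (0 : Fin 4 → K) ua ≠ 0) (hha : ha ∈ originIdeal K)
    (hGa : ua * ((c (k + 2)).F.divMonomial (c (k + 2)).r) ∈
      Ideal.span {(X (j k) : MvPolynomial (Fin 4) K), ha ^ d})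
    (hub : MvPolynomial.eval (0 : Fin 4 → K) ub ≠ 0) (hhb : hb ∈ originIdeal K)
    (hGb : ub * ((c (k + 2)).F.divMonomial (c (k + 2)).r) ∈
      Ideal.span {(X (j (k + 1)) : MvPolynomial (Fin 4) K), hb ^ d}) :
    (c (k + 2)).r (j k) + (c (k + 2)).r (j (k + 1)) + 3 ≤ p := by
  by_contra hlt
  exact stretch_false_of_two_ledgers p hc hr0 hfloor hd2 hdp hshade (show k₀ ≤ k + 2 by omega) hform
    hsat.1.symm hea heb he hua hha hGa hub hhb hGb (by omega)

/-- **(K12b, explicit-ledger form) At a ledgered satellite step the two consecutive orders satisfy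
`oₖ + oₖ₊₁ + 3 ≤ 3p`** (`oₖ = ord₀ F_k`, `oₖ₊₁ = ord₀ F_{k+1}`; the band gives only `≤ 4p − 2` and the layer
bookkeeping `≤ 3p − 2` for every consecutive pair — (DL) buys exactly one at satellite steps).  At `p = 5`
(`o ∈ {6, 7, 8}`): `(oₖ, oₖ₊₁) = (6, 6)`. [cite: CossartJannsenSaito2020, Thm. 3.14] [folklore] -/
theorem satellite_orders_add_three_le_of_ledgers (p : ℕ) [Fact p.Prime] [CharP K p] [DecidableEq K]
    {c : ℕ → State K} {j : ℕ → Fin 4} {b : ℕ → Fin 4 → K}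
    (hc : ∀ k, IsIsolated p (c k).F ∧ Step0 p (c k) (c (k + 1))) (hw : FreeTail.IsWitnessedChain p c j b)
    (hr0 : ∀ e ∈ (c 0).F.support, (c 0).r ≤ e) (hfloor : ∀ k, ordZero (c k).F ≠ p) {k₀ d : ℕ}
    (hd2 : 2 ≤ d) (hdp : d < p) (hshade : ∀ k, k₀ ≤ k → (c k).shade = (d : ℕ∞)) {k : ℕ} (hk : k₀ ≤ k)
    (hsat : FreeTail.IsSatellite j b k) {ℓ : Fin 4 → K} {a₀ : K}
    (hform : resForm (c (k + 2)) = C a₀ * (∑ i, C (ℓ i) * X i) ^ d)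
    {e : Fin 4} (hea : e ≠ j k) (heb : e ≠ j (k + 1)) (he : ℓ e ≠ 0)
    {ua ha ub hb : MvPolynomial (Fin 4) K}
    (hua : MvPolynomial.eval (0 : Fin 4 → K) ua ≠ 0) (hha : ha ∈ originIdeal K)
    (hGa : ua * ((c (k + 2)).F.divMonomial (c (k + 2)).r) ∈
      Ideal.span {(X (j k) : MvPolynomial (Fin 4) K), ha ^ d})
    (hub : MvPolynomial.eval (0 : Fin 4 → K) ub ≠ 0) (hhb : hb ∈ originIdeal K)
    (hGb : ub * ((c (k + 2)).F.divMonomial (c (k + 2)).r) ∈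
      Ideal.span {(X (j (k + 1)) : MvPolynomial (Fin 4) K), hb ^ d})
    {oₖ oₖ₁ : ℕ} (hoₖ : ordZero (c k).F = oₖ) (hoₖ₁ : ordZero (c (k + 1)).F = oₖ₁) :
    oₖ + oₖ₁ + 3 ≤ 3 * p := by
  obtain ⟨oₖ', oₖ₁', hoₖ', hoₖ₁', -, -, hsum⟩ := satellite_pair_sum p hc hw hfloor hsat
  have e1 : oₖ' = oₖ := by
    have h := hoₖ'.symm.trans hoₖ
    exact_mod_cast h
  have e2 : oₖ₁' = oₖ₁ := by
    have h := hoₖ₁'.symm.trans hoₖ₁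
    exact_mod_cast h
  subst e1 e2
  have hlight := satellite_pair_light_of_ledgers p hc hr0 hfloor hd2 hdp hshade hk hsat hform hea heb
    he hua hha hGa hub hhb hGb
  omega

end ResCone

end Summit.ResolutionOfSingularities.ResolutionOfSingularities.Theorems.PIDim4

end
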